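import Mathlib.Analysis.Normed.Module.Multilinear.Curry
import Mathlib.Topology.Algebra.Module.Multilinear.Topology
import Mathlib.Analysis.Normed.Operator.Mul
import Mathlib.LinearAlgebra.Alternating.DomCoprod
import Mathlib.LinearAlgebra.BilinearMap
import Mathlib.GroupTheory.Perm.Fin
import Mathlib.Analysis.Calculus.DifferentialForm.Basic
import Mathlib.Analysis.Convex.Basic
import Mathlib.Geometry.Manifold.MFDeriv.Basic
import Mathlib.Geometry.Manifold.MFDeriv.SpecificFunctions
import Mathlib.Geometry.Manifold.ContMDiff.Basic
import Mathlib.Geometry.Manifold.IsManifold.Basic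
import Literature.Geometry.Kaehler.AlternatingAux
import Literature.Geometry.Kaehler.ManifoldForms
import HarnessLib

-- provenance: harness21/H21/H21/Prelude/TranscendKaehlerL/FormsAlgebra.lean @ c661e31 (interim HEAD d8f2665); M5 mechanical rewrite
/-!
# Algebra of differential forms: wedge product, degree casts, pull-back, cup product

Trunk: TranscendKaehlerL (`H21/Outlines/TranscendKaehlerL.md`, item **C6 FormsAlgebra**), notion
`de_rham_cohomology_manifold` (algebraic part). This file extends the thin slice of differential
forms on real manifolds of `Literature.Prelude.Kaehler.ManifoldForms` (`MForm`, `IsSmoothForm`,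
`mextDeriv`, `closedSmoothForms`, `exactSmoothForms`, `deRhamCohomology`) by

* the **wedge product** `ContinuousAlternatingMap.wedge` of continuous alternating maps on a
  normed space with values in a normed commutative `𝕜`-algebra `A` (`A = ℝ, ℂ`), with the
  shuffle normalisation `(α ∧ β)(v) = (k! l!)⁻¹ ∑_σ sign σ · α(v ∘ σ|₁) β(v ∘ σ|₂)`
  (Warner (1983), 2.10(b); Spivak), and its pointwise version `Literature.Geometry.Kaehler.MForm.wedge` on manifolds;
* degree casts `Literature.Geometry.Kaehler.MForm.castDeg` along `k = k'` (never `n - k`);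
* the **pull-back** `Literature.MForm.pullback I f β` of a form along a map of manifolds, using
  `mfderiv`;
* the calculus: bilinearity, associativity and graded commutativity of `∧`, the Leibniz rule
  `d(α ∧ β) = dα ∧ β + (-1)^k α ∧ dβ`, naturality `f^*(α ∧ β) = f^*α ∧ f^*β`, `f^* d = d f^*`,
  functoriality of `f^*`, the Poincaré lemma on convex open subsets of `E`;
* the induced maps on de Rham cohomology: `Literature.deRhamCohomology.map hf k = f^*` and the
  **cup product** `Literature.Geometry.Kaehler.deRhamCohomology.cup`, with functoriality, naturality, graded
  commutativity and associativity.

All definitions are real. The deep facts whose proofs are deferred are vendored as **named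
facts** (D-0014: `Prop`-valued definitions `ContinuousAlternatingMap.WedgeAssoc`, `.WedgeComm`,
`.ToAlternatingMapWedge`, `Literature.NumberTheory.Transcendental.IsSmoothFormWedge`, `Literature.NumberTheory.Transcendental.MextDerivWedge`,
`Literature.NumberTheory.Transcendental.IsSmoothFormPullback`, `Literature.NumberTheory.Transcendental.MextDerivPullback`,
`Literature.NumberTheory.Transcendental.ExactSmoothFormsEqClosedSmoothFormsOfConvex`); the ones consumed by the constructions of
this file are bundled in the two `Prop`-valued classes `Literature.WedgeFacts I M A` (wedge calculus on
one manifold) and `Literature.PullbackFacts I M I' N F` (pull-back calculus along maps `M → N`), house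
pattern `SphereEmbedding.SmoothnessFacts` / `HodgeTensorFacts` / `Kerr.Facts`; consumers add
the instance hypotheses `[WedgeFacts I M A]` / `[PullbackFacts I M I' N F]`.

## Mathlib status (pinned v4.32.0) and duplication defence

Mathlib has no wedge product of (continuous) alternating maps with values in an algebra and no
pull-back / cup product on de Rham cohomology of manifolds. Its only relative of `∧` is the
*algebraic* shuffle product `AlternatingMap.domCoprod`
(`Mathlib/LinearAlgebra/Alternating/DomCoprod.lean`), valued in the tensor product `N₁ ⊗ N₂` and
indexed by `ιa ⊕ ιb`. Our `wedge` is built from continuous pieces that Mathlib does have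
(`ContinuousMultilinearMap.uncurrySum`, `.domDomCongr`, `.alternatization`,
`ContinuousLinearMap.compContinuousMultilinearMapL`, `ContinuousLinearMap.mul`,
`finSumFinEquiv`) and the comparison with `domCoprod` is stated as
the named fact `ContinuousAlternatingMap.ToAlternatingMapWedge`. Pull-back on a normed space appears in
Mathlib only inline (`extDeriv_pullback`: `fun x ↦ (ω (f x)).compContinuousLinearMap
(fderiv 𝕜 f x)`); `Literature.Geometry.Kaehler.MForm.pullback` is the manifold version with `mfderiv`. Cohomology maps
use `Submodule.mapQ` / `Submodule.liftQ`.

## Design notes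

* `ContinuousAlternatingMap.wedge` and its lemmas are *deliberate* dot-notation extensions of the
  Mathlib namespace `ContinuousAlternatingMap` (upstreaming candidates), like G21's
  `ContinuousAlternatingMap.domDomCongr`; everything else is in `namespace Literature`.
* No `[NormOneClass A]` is assumed (nothing uses it). Scalars are `[RCLike 𝕜]` because of the
  `(k! l!)⁻¹` normalisation.
* G21 conventions: forms are never named `ω`; alternating gadgets are built on the model space
  `E` and ascribed with `letI a : E [⋀^Fin k]→L[ℝ] A := α x` (the tangent space carries no
  `NormedAddCommGroup` instance); degrees are related by explicit equations `h : k + l = m`;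
  `[IsManifold I ∞ M]` only where chart compatibility is used (pull-back calculus,
  `deRhamCohomology.map`); the Leibniz rule and the cup product need none.
* The Poincaré lemma assumes `[CompleteSpace F]` (it fails for non-complete coefficients).
* `MForm.pullback` takes the source model with corners `I` *explicitly* (it cannot be inferred
  from `f : M → N`), so one writes `β.pullback I f`.
* Cohomology-level definitions consume the named facts only through the instance hypotheses
  `[WedgeFacts I M A]` / `[PullbackFacts I M I' N F]` and only in membership proofs, each
  recorded in a `Relies on:` docstring line.

## References

* F. W. Warner, *Foundations of Differentiable Manifolds and Lie Groups* (1983), §§2.5–2.10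
  (exterior algebra, wedge), 2.22–2.23 (pull-back, naturality of `d`), 4.1–4.3, 4.18
  (de Rham cohomology, Poincaré lemma).
* R. Bott, L. W. Tu, *Differential Forms in Algebraic Topology* (1982), §I.1–I.2, Cor. 4.1.1.
* Mathlib: `Mathlib/LinearAlgebra/Alternating/DomCoprod.lean` (`AlternatingMap.domCoprod`),
  `Mathlib/Analysis/Calculus/DifferentialForm/Basic.lean` (`extDeriv_pullback`).
-/

noncomputable section

open scoped Manifold ContDiff Topology
open Set

/-! ### The wedge product of continuous alternating maps -/

namespace ContinuousAlternatingMap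

section Wedge

variable {𝕜 : Type*} [RCLike 𝕜] {V W : Type*} [NormedAddCommGroup V] [NormedSpace 𝕜 V]
  [NormedAddCommGroup W] [NormedSpace 𝕜 W]
  {A : Type*} [NormedCommRing A] [NormedAlgebra 𝕜 A] {k l m : ℕ}

/-- The **wedge product** `α ∧ β` of continuous alternating maps of degrees `k` and `l` on a
normed space `V` with values in a normed commutative `𝕜`-algebra `A`, a continuous alternating
map of degree `k + l`:
`(α ∧ β)(v) = (k! l!)⁻¹ ∑_{σ ∈ 𝔖_{k+l}} sign σ · α(v_{σ(0)}, …, v_{σ(k-1)}) β(v_{σ(k)}, …)`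
(equivalently, the sum over `(k,l)`-shuffles). Built as
`alternatization ∘ domDomCongr finSumFinEquiv ∘ uncurrySum` of the continuous multilinear map
`(v, w) ↦ α v * β w`. Warner (1983), 2.10(b) (this normalisation); Bott–Tu (1982), §I.1.
Mathlib's algebraic relative is the tensor-valued shuffle product `AlternatingMap.domCoprod`
(`LinearAlgebra/Alternating/DomCoprod.lean`); see `ToAlternatingMapWedge` for the comparison.
Deliberate extension of the Mathlib namespace `ContinuousAlternatingMap`. [cite: Warner1983] -/
def wedge (α : V [⋀^Fin k]→L[𝕜] A) (β : V [⋀^Fin l]→L[𝕜] A) : V [⋀^Fin (k + l)]→L[𝕜] A :=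
  letI φ : ContinuousMultilinearMap 𝕜 (fun _ : Fin k ↦ V)
      (ContinuousMultilinearMap 𝕜 (fun _ : Fin l ↦ V) A) :=
    ((ContinuousLinearMap.compContinuousMultilinearMapL 𝕜 (fun _ : Fin l ↦ V) A A).flip
        β.toContinuousMultilinearMap).compContinuousMultilinearMap
      ((ContinuousLinearMap.mul 𝕜 A).compContinuousMultilinearMap α.toContinuousMultilinearMap)
  letI ψ : ContinuousMultilinearMap 𝕜 (fun _ : Fin (k + l) ↦ V) A :=
    ContinuousMultilinearMap.domDomCongr finSumFinEquiv φ.uncurrySum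
  ((k.factorial * l.factorial : ℕ) : 𝕜)⁻¹ • ContinuousMultilinearMap.alternatization ψ

/-- The shuffle (permutation) formula for the wedge product:
`(α ∧ β)(v) = (k! l!)⁻¹ ∑_σ sign σ · α(v ∘ σ ∘ castAdd) · β(v ∘ σ ∘ natAdd)`.
Warner (1983), 2.10(b). [cite: Warner1983] -/
theorem wedge_apply (α : V [⋀^Fin k]→L[𝕜] A) (β : V [⋀^Fin l]→L[𝕜] A) (v : Fin (k + l) → V) :
    α.wedge β v = ((k.factorial * l.factorial : ℕ) : 𝕜)⁻¹ • ∑ σ : Equiv.Perm (Fin (k + l)),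
      Equiv.Perm.sign σ •
        (α (fun i ↦ v (σ (Fin.castAdd l i))) * β (fun j ↦ v (σ (Fin.natAdd k j)))) := by
  simp [wedge, ContinuousMultilinearMap.alternatization_apply_apply, Function.comp_def]

/-- Auxiliary: a sum over the permutations of `Fin (1 + 1)` has the two terms `1` and
`swap 0 1` (stated for `Fin (1 + 1)` rather than `Fin 2` because that is the index type of
`α.wedge β` for `k = l = 1`; Mathlib has only `Finset.univ_perm_fin_succ`; upstreaming
candidate). [folklore] -/
private theorem sum_perm_fin_one_add_one {N : Type*} [AddCommMonoid N]
    (f : Equiv.Perm (Fin (1 + 1)) → N) :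
    ∑ σ : Equiv.Perm (Fin (1 + 1)), f σ = f 1 + f (Equiv.swap 0 1) := by
  rw [Finset.univ_perm_fin_succ, Finset.sum_map, Fintype.sum_prod_type]
  simp only [Fin.sum_univ_two, Finset.univ_unique, Finset.sum_singleton]
  have h : (finSuccEquiv 1).symm.permCongr (Equiv.swap none ((finSuccEquiv 1) 1)) =
      Equiv.swap 0 1 := by
    decide
  simp [Equiv.Perm.decomposeFin, Equiv.Perm.decomposeOption, h]
  rfl

/-- The wedge of two `1`-forms: `(α ∧ β)(v₀, v₁) = α(v₀) β(v₁) - α(v₁) β(v₀)`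
(Warner (1983), 2.10(b) with `k = l = 1`; a check of the normalisation). [cite: Warner1983] -/
theorem wedge_apply_one_one (α β : V [⋀^Fin 1]→L[𝕜] A) (v : Fin (1 + 1) → V) :
    α.wedge β v = α ![v 0] * β ![v 1] - α ![v 1] * β ![v 0] := by
  rw [wedge_apply, sum_perm_fin_one_add_one]
  have h1 : (fun i : Fin 1 ↦ v (Fin.castAdd 1 i)) = ![v 0] := by funext i; fin_cases i; rfl
  have h2 : (fun j : Fin 1 ↦ v j.succ) = ![v 1] := by funext i; fin_cases i; rfl
  have h3 : (fun i : Fin 1 ↦ v (Equiv.swap 0 1 (Fin.castAdd 1 i))) = ![v 1] := by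
    funext i; fin_cases i; rfl
  have h4 : (fun j : Fin 1 ↦ v (Equiv.swap 0 1 j.succ)) = ![v 0] := by
    funext i; fin_cases i; rfl
  simp [Units.smul_def, sub_eq_add_neg, h1, h2, h3, h4]

/-- The wedge product is additive in the left factor (Warner (1983), 2.6: `∧` is bilinear). [cite: Warner1983] -/
theorem wedge_add_left (α₁ α₂ : V [⋀^Fin k]→L[𝕜] A) (β : V [⋀^Fin l]→L[𝕜] A) :
    (α₁ + α₂).wedge β = α₁.wedge β + α₂.wedge β := by
  ext v
  simp only [wedge_apply, add_apply, add_mul, smul_add, Finset.sum_add_distrib]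

/-- The wedge product is additive in the right factor (Warner (1983), 2.6). [cite: Warner1983] -/
theorem wedge_add_right (α : V [⋀^Fin k]→L[𝕜] A) (β₁ β₂ : V [⋀^Fin l]→L[𝕜] A) :
    α.wedge (β₁ + β₂) = α.wedge β₁ + α.wedge β₂ := by
  ext v
  simp only [wedge_apply, add_apply, mul_add, smul_add, Finset.sum_add_distrib]

/-- The wedge product commutes with scalars in the left factor (Warner (1983), 2.6). [cite: Warner1983] -/
theorem wedge_smul_left (c : 𝕜) (α : V [⋀^Fin k]→L[𝕜] A) (β : V [⋀^Fin l]→L[𝕜] A) :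
    (c • α).wedge β = c • α.wedge β := by
  ext v
  simp only [wedge_apply, smul_apply, smul_mul_assoc, Finset.smul_sum]
  refine Finset.sum_congr rfl fun σ _ ↦ ?_
  rw [smul_comm (Equiv.Perm.sign σ) c, smul_comm _ c]

/-- The wedge product commutes with scalars in the right factor (Warner (1983), 2.6). [cite: Warner1983] -/
theorem wedge_smul_right (c : 𝕜) (α : V [⋀^Fin k]→L[𝕜] A) (β : V [⋀^Fin l]→L[𝕜] A) :
    α.wedge (c • β) = c • α.wedge β := by
  ext v
  simp only [wedge_apply, smul_apply, mul_smul_comm, Finset.smul_sum]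
  refine Finset.sum_congr rfl fun σ _ ↦ ?_
  rw [smul_comm (Equiv.Perm.sign σ) c, smul_comm _ c]

/-- Wedge with the zero form on the left is zero (Warner (1983), 2.6: bilinearity). [cite: Warner1983] -/
@[simp]
theorem zero_wedge (β : V [⋀^Fin l]→L[𝕜] A) : (0 : V [⋀^Fin k]→L[𝕜] A).wedge β = 0 := by
  ext v
  simp [wedge_apply]

/-- Wedge with the zero form on the right is zero (Warner (1983), 2.6: bilinearity). [cite: Warner1983] -/
@[simp]
theorem wedge_zero (α : V [⋀^Fin k]→L[𝕜] A) : α.wedge (0 : V [⋀^Fin l]→L[𝕜] A) = 0 := by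
  ext v
  simp [wedge_apply]

variable (𝕜 V A) in
/-- **Associativity** of the wedge product, up to the reindexing `Fin (k + (l + m)) ≃
Fin (k + l + m)`: `(α ∧ β) ∧ γ = α ∧ (β ∧ γ)`, for all degrees `k l m`. Warner (1983), 2.6 / 2.10.
Named fact (D-0014); over `ℝ` it is the field `wedge_assoc` of `Literature.NumberTheory.Transcendental.WedgeFacts`. [cite: Warner1983, 2.6 / 2.10] -/
def WedgeAssoc : Prop :=
  ∀ {k l m : ℕ} (α : V [⋀^Fin k]→L[𝕜] A) (β : V [⋀^Fin l]→L[𝕜] A) (γ : V [⋀^Fin m]→L[𝕜] A),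
    (α.wedge β).wedge γ =
      (α.wedge (β.wedge γ)).domDomCongr (finCongr (Nat.add_assoc k l m).symm)

variable (𝕜 V A) in
/-- **Graded commutativity** of the wedge product: `β ∧ α = (-1)^{kl} α ∧ β` (up to the
reindexing `Fin (k + l) ≃ Fin (l + k)`), for all degrees `k l`. Warner (1983), 2.6 / 2.10.
Named fact (D-0014); over `ℝ` it is the field `wedge_comm` of `Literature.NumberTheory.Transcendental.WedgeFacts`. [cite: Warner1983, 2.6 / 2.10] -/
def WedgeComm : Prop :=
  ∀ {k l : ℕ} (α : V [⋀^Fin k]→L[𝕜] A) (β : V [⋀^Fin l]→L[𝕜] A),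
    β.wedge α = ((-1 : 𝕜) ^ (k * l)) • (α.wedge β).domDomCongr (finCongr (Nat.add_comm k l))

/-- The unit `1 : A`, viewed as a `0`-form, is a left unit for `∧` (up to reindexing along
`0 + l = l`). Warner (1983), 2.6. Proof: in the shuffle formula every summand equals
`β (v ∘ Fin.cast _)` (reindex the permutation to `Fin l` and use `AlternatingMap.map_perm`;
the two signs cancel), so the sum is `(0 + l)! = 0! l!` copies of it. [cite: Warner1983, 2.6] -/
theorem constOfIsEmpty_one_wedge (β : V [⋀^Fin l]→L[𝕜] A) :
    (constOfIsEmpty 𝕜 V (Fin 0) (1 : A)).wedge β =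
      β.domDomCongr (finCongr (Nat.zero_add l).symm) := by
  ext v
  rw [wedge_apply, domDomCongr_apply]
  have hterm : ∀ σ : Equiv.Perm (Fin (0 + l)),
      Equiv.Perm.sign σ • ((constOfIsEmpty 𝕜 V (Fin 0) (1 : A))
        (fun i ↦ v (σ (Fin.castAdd l i))) * β (fun j ↦ v (σ (Fin.natAdd 0 j)))) =
        β (v ∘ finCongr (Nat.zero_add l).symm) := by
    intro σ
    have h1 : (fun j ↦ v (σ (Fin.natAdd 0 j))) =
        (v ∘ finCongr (Nat.zero_add l).symm) ∘
          ((finCongr (Nat.zero_add l).symm).symm.permCongr σ) := by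
      funext j
      simp only [Function.comp_apply, Equiv.permCongr_apply, Equiv.symm_symm,
        Equiv.apply_symm_apply, Fin.natAdd_zero, finCongr_apply]
    rw [constOfIsEmpty_apply, one_mul, h1, ← coe_toAlternatingMap, AlternatingMap.map_perm,
      Equiv.Perm.sign_permCongr, smul_smul, Int.units_mul_self, one_smul]
  have hfac : Nat.factorial 0 * l.factorial = (0 + l).factorial := by
    rw [Nat.factorial_zero, one_mul, Nat.zero_add]
  rw [Finset.sum_congr rfl fun σ _ ↦ hterm σ, Finset.sum_const, Finset.card_univ,
    Fintype.card_perm, Fintype.card_fin, hfac, ← Nat.cast_smul_eq_nsmul 𝕜, smul_smul,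
    inv_mul_cancel₀ (Nat.cast_ne_zero.2 (Nat.factorial_ne_zero _)), one_smul]

/-- The wedge product is natural under precomposition with a continuous linear map:
`(α ∧ β) ∘ g = (α ∘ g) ∧ (β ∘ g)` (Warner (1983), 2.22(c), linear case). [cite: Warner1983] -/
theorem wedge_compContinuousLinearMap (α : V [⋀^Fin k]→L[𝕜] A) (β : V [⋀^Fin l]→L[𝕜] A)
    (g : W →L[𝕜] V) :
    (α.wedge β).compContinuousLinearMap g =
      (α.compContinuousLinearMap g).wedge (β.compContinuousLinearMap g) := by
  ext v
  simp only [compContinuousLinearMap_apply, wedge_apply, Function.comp_def]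

variable (𝕜 V A) in
/-- **Duplication defence.** The underlying alternating map of `α ∧ β` is Mathlib's algebraic
shuffle product `AlternatingMap.domCoprod` of the underlying alternating maps (valued in
`A ⊗[𝕜] A`), followed by multiplication `A ⊗ A → A` and reindexed along
`Fin k ⊕ Fin l ≃ Fin (k + l)`. (`domCoprod` sums over shuffles, whence our `(k! l!)⁻¹`: the
full-permutation sum of Warner (1983), 2.10(b) is `k! l!` times the shuffle sum.)
Named fact (D-0014). [cite: Warner1983, 2.10(b)] -/
def ToAlternatingMapWedge : Prop :=
  ∀ {k l : ℕ} (α : V [⋀^Fin k]→L[𝕜] A) (β : V [⋀^Fin l]→L[𝕜] A),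
    (α.wedge β).toAlternatingMap =
      ((LinearMap.mul' 𝕜 A).compAlternatingMap
        (α.toAlternatingMap.domCoprod β.toAlternatingMap)).domDomCongr finSumFinEquiv

end Wedge

end ContinuousAlternatingMap

namespace Literature.NumberTheory.Transcendental

variable {E : Type*} [NormedAddCommGroup E] [NormedSpace ℝ E]
  {H : Type*} [TopologicalSpace H] {I : ModelWithCorners ℝ E H}
  {M : Type*} [TopologicalSpace M] [ChartedSpace H M]
  {E' : Type*} [NormedAddCommGroup E'] [NormedSpace ℝ E']
  {H' : Type*} [TopologicalSpace H'] {I' : ModelWithCorners ℝ E' H'}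
  {N : Type*} [TopologicalSpace N] [ChartedSpace H' N]
  {E'' : Type*} [NormedAddCommGroup E''] [NormedSpace ℝ E'']
  {H'' : Type*} [TopologicalSpace H''] {I'' : ModelWithCorners ℝ E'' H''}
  {P : Type*} [TopologicalSpace P] [ChartedSpace H'' P]
  {F : Type*} [NormedAddCommGroup F] [NormedSpace ℝ F]
  {A : Type*} [NormedCommRing A] [NormedAlgebra ℝ A]
  {k l m k' : ℕ}

/-! ### Wedge, degree casts and pull-back of forms on manifolds -/

section MForm
open Literature.Geometry.Kaehler (MForm)
open Literature.Geometry.Kaehler.MForm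

/-- The pointwise **wedge product** of an `A`-valued `k`-form and `l`-form on a manifold,
`(α ∧ β)(x) = α(x) ∧ β(x)` (computed on the model space `E` via
`ContinuousAlternatingMap.wedge` and ascribed back to the tangent space).
Warner (1983), 2.17; Bott–Tu (1982), §I.1. [cite: Warner1983] -/
def _root_.Literature.Geometry.Kaehler.MForm.wedge (α : MForm I M A k) (β : MForm I M A l) : MForm I M A (k + l) := fun x ↦
  letI a : E [⋀^Fin k]→L[ℝ] A := α x
  letI b : E [⋀^Fin l]→L[ℝ] A := β x
  letI c : E [⋀^Fin (k + l)]→L[ℝ] A := a.wedge b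
  c

/-- Pointwise formula for the wedge of forms (definitional; Warner (1983), 2.17). [cite: Warner1983] -/
theorem _root_.Literature.Geometry.Kaehler.MForm.wedge_apply (α : MForm I M A k) (β : MForm I M A l) (x : M) :
    α.wedge β x =
      (letI a : E [⋀^Fin k]→L[ℝ] A := α x
      letI b : E [⋀^Fin l]→L[ℝ] A := β x
      (a.wedge b : E [⋀^Fin (k + l)]→L[ℝ] A)) :=
  rfl

/-- The wedge of forms is additive on the left (pointwise from
`ContinuousAlternatingMap.wedge_add_left`; Warner (1983), 2.6). [cite: Warner1983] -/
theorem _root_.Literature.Geometry.Kaehler.MForm.wedge_add_left (α₁ α₂ : MForm I M A k) (β : MForm I M A l) :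
    (α₁ + α₂).wedge β = α₁.wedge β + α₂.wedge β :=
  funext fun x ↦ ContinuousAlternatingMap.wedge_add_left (V := E) (α₁ x) (α₂ x) (β x)

/-- The wedge of forms is additive on the right (Warner (1983), 2.6). [cite: Warner1983] -/
theorem _root_.Literature.Geometry.Kaehler.MForm.wedge_add_right (α : MForm I M A k) (β₁ β₂ : MForm I M A l) :
    α.wedge (β₁ + β₂) = α.wedge β₁ + α.wedge β₂ :=
  funext fun x ↦ ContinuousAlternatingMap.wedge_add_right (V := E) (α x) (β₁ x) (β₂ x)

/-- The wedge of forms commutes with scalars on the left (Warner (1983), 2.6). [cite: Warner1983] -/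
theorem _root_.Literature.Geometry.Kaehler.MForm.wedge_smul_left (c : ℝ) (α : MForm I M A k) (β : MForm I M A l) :
    (c • α).wedge β = c • α.wedge β :=
  funext fun x ↦ ContinuousAlternatingMap.wedge_smul_left (V := E) c (α x) (β x)

/-- The wedge of forms commutes with scalars on the right (Warner (1983), 2.6). [cite: Warner1983] -/
theorem _root_.Literature.Geometry.Kaehler.MForm.wedge_smul_right (c : ℝ) (α : MForm I M A k) (β : MForm I M A l) :
    α.wedge (c • β) = c • α.wedge β :=
  funext fun x ↦ ContinuousAlternatingMap.wedge_smul_right (V := E) c (α x) (β x)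

/-- Wedge with the zero form on the left vanishes (Warner (1983), 2.6). [cite: Warner1983] -/
@[simp]
theorem _root_.Literature.Geometry.Kaehler.MForm.zero_wedge (β : MForm I M A l) : (0 : MForm I M A k).wedge β = 0 :=
  funext fun x ↦ ContinuousAlternatingMap.zero_wedge (V := E) (β x)

/-- Wedge with the zero form on the right vanishes (Warner (1983), 2.6). [cite: Warner1983] -/
@[simp]
theorem _root_.Literature.Geometry.Kaehler.MForm.wedge_zero (α : MForm I M A k) : α.wedge (0 : MForm I M A l) = 0 :=
  funext fun x ↦ ContinuousAlternatingMap.wedge_zero (V := E) (α x)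

/-- **Degree cast** of a form along an equation of degrees `h : k = k'` (reindexing the
arguments along `finCongr h`, via `ContinuousAlternatingMap.domDomCongr`). Used to state
identities between forms whose degrees agree only propositionally (`(k + 1) + l = (k + l) + 1`),
never via natural-number subtraction. [folklore] -/
def _root_.Literature.Geometry.Kaehler.MForm.castDeg (h : k = k') (α : MForm I M F k) : MForm I M F k' := fun x ↦
  letI a : E [⋀^Fin k]→L[ℝ] F := α x
  letI b : E [⋀^Fin k']→L[ℝ] F := a.domDomCongr (finCongr h)
  b

/-- Evaluation of a degree-cast form: `(α.castDeg h) x v = α x (v ∘ Fin.cast h)`. [folklore] -/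
@[simp]
theorem _root_.Literature.Geometry.Kaehler.MForm.castDeg_apply (h : k = k') (α : MForm I M F k) (x : M) (v : Fin k' → TangentSpace I x) :
    α.castDeg h x v = α x (fun i ↦ v (Fin.cast h i)) :=
  rfl

/-- Casting along `rfl` does nothing (API for `castDeg`; no literature counterpart). [folklore] -/
@[simp]
theorem _root_.Literature.Geometry.Kaehler.MForm.castDeg_rfl (α : MForm I M F k) : α.castDeg rfl = α :=
  rfl

/-- Degree casts compose (API for `castDeg`; no literature counterpart). [folklore] -/
theorem _root_.Literature.Geometry.Kaehler.MForm.castDeg_castDeg {k'' : ℕ} (h : k = k') (h' : k' = k'') (α : MForm I M F k) :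
    (α.castDeg h).castDeg h' = α.castDeg (h.trans h') :=
  rfl

/-- Degree cast is additive (API for `castDeg`; no literature counterpart). [folklore] -/
@[simp]
theorem _root_.Literature.Geometry.Kaehler.MForm.castDeg_add (h : k = k') (α β : MForm I M F k) :
    (α + β).castDeg h = α.castDeg h + β.castDeg h :=
  rfl

/-- Degree cast commutes with scalars (API for `castDeg`; no literature counterpart). [folklore] -/
@[simp]
theorem _root_.Literature.Geometry.Kaehler.MForm.castDeg_smul (h : k = k') (c : ℝ) (α : MForm I M F k) :
    (c • α).castDeg h = c • α.castDeg h :=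
  rfl

/-- Degree cast of the zero form (API for `castDeg`; no literature counterpart). [folklore] -/
@[simp]
theorem _root_.Literature.Geometry.Kaehler.MForm.castDeg_zero (h : k = k') : (0 : MForm I M F k).castDeg h = 0 :=
  rfl

variable (I) in
/-- The **pull-back** `f^* β` of a `k`-form `β` on `N` along a map `f : M → N` of manifolds:
`(f^* β)(x)(v₁, …, v_k) = β(f x)(df_x v₁, …, df_x v_k)` with `df_x = mfderiv I I' f x`.
The source model with corners `I` is explicit. Junk value: where `f` is not
`MDifferentiableAt`, Mathlib's `mfderiv I I' f x` is `0`, so `(f^* β) x` is `0` in positive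
degree (and `β (f x)` in degree `0`); the API lemmas needing the chain rule assume
`MDifferentiable`/`ContMDiff`. Warner (1983), 2.22; Bott–Tu (1982), §I.2.
Cf. Mathlib's inline normed-space pull-back in `extDeriv_pullback`. [cite: Warner1983] -/
def _root_.Literature.Geometry.Kaehler.MForm.pullback (f : M → N) (β : MForm I' N F k) : MForm I M F k := fun x ↦
  (β (f x)).compContinuousLinearMap (mfderiv I I' f x)

/-- Evaluation of a pulled-back form (definitional; Warner (1983), 2.22). [cite: Warner1983] -/
@[simp]
theorem _root_.Literature.Geometry.Kaehler.MForm.pullback_apply (f : M → N) (β : MForm I' N F k) (x : M) (v : Fin k → TangentSpace I x) :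
    β.pullback I f x v = β (f x) (fun i ↦ mfderiv I I' f x (v i)) :=
  rfl

/-- Pull-back is additive in the form (Warner (1983), 2.22). [cite: Warner1983] -/
@[simp]
theorem _root_.Literature.Geometry.Kaehler.MForm.pullback_add (f : M → N) (β₁ β₂ : MForm I' N F k) :
    (β₁ + β₂).pullback I f = β₁.pullback I f + β₂.pullback I f :=
  rfl

/-- Pull-back commutes with scalars (Warner (1983), 2.22). [cite: Warner1983] -/
@[simp]
theorem _root_.Literature.Geometry.Kaehler.MForm.pullback_smul (f : M → N) (c : ℝ) (β : MForm I' N F k) :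
    (c • β).pullback I f = c • β.pullback I f :=
  rfl

/-- Pull-back of the zero form (Warner (1983), 2.22: linearity of `f^*`). [cite: Warner1983] -/
@[simp]
theorem _root_.Literature.Geometry.Kaehler.MForm.pullback_zero (f : M → N) : (0 : MForm I' N F k).pullback I f = 0 :=
  rfl

variable (I) in
/-- The bundled `ℝ`-linear pull-back map on all forms `β ↦ f^* β` (Warner (1983), 2.22). [cite: Warner1983] -/
def _root_.Literature.Geometry.Kaehler.MForm.pullbackₗ (f : M → N) (k : ℕ) : MForm I' N F k →ₗ[ℝ] MForm I M F k where
  toFun β := β.pullback I f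
  map_add' _ _ := rfl
  map_smul' _ _ := rfl

/-- `pullbackₗ I f k β` is `β.pullback I f` (definitional; Warner (1983), 2.22). [cite: Warner1983] -/
@[simp]
theorem _root_.Literature.Geometry.Kaehler.MForm.pullbackₗ_apply (f : M → N) (β : MForm I' N F k) : pullbackₗ I f k β = β.pullback I f :=
  rfl

/-- Pull-back commutes with degree casts (API for `castDeg`; no literature counterpart). [folklore] -/
theorem _root_.Literature.Geometry.Kaehler.MForm.pullback_castDeg (f : M → N) (h : k = k') (β : MForm I' N F k) :
    (β.castDeg h).pullback I f = (β.pullback I f).castDeg h :=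
  rfl

/-- Pull-back along the identity is the identity (Warner (1983), 2.22). [cite: Warner1983] -/
@[simp]
theorem _root_.Literature.Geometry.Kaehler.MForm.pullback_id (α : MForm I M F k) : α.pullback I (id : M → M) = α := by
  funext x
  ext v
  simp only [pullback_apply, mfderiv_id]
  rfl

/-- Pull-back is contravariantly functorial: `(g ∘ f)^* = f^* ∘ g^*` for differentiable maps
(chain rule for `mfderiv`; Warner (1983), 2.22). [cite: Warner1983] -/
theorem _root_.Literature.Geometry.Kaehler.MForm.pullback_comp {g : N → P} {f : M → N} (hg : MDifferentiable I' I'' g)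
    (hf : MDifferentiable I I' f) (γ : MForm I'' P F k) :
    γ.pullback I (g ∘ f) = (γ.pullback I' g).pullback I f := by
  funext x
  ext v
  simp only [pullback_apply, Function.comp_apply, mfderiv_comp x (hg (f x)) (hf x)]
  rfl

/-- Pull-back is compatible with the wedge product: `f^*(α ∧ β) = f^*α ∧ f^*β`
(Warner (1983), 2.22(c)). Purely algebraic (no smoothness needed). [cite: Warner1983] -/
theorem _root_.Literature.Geometry.Kaehler.MForm.pullback_wedge (f : M → N) (α : MForm I' N A k) (β : MForm I' N A l) :
    (α.wedge β).pullback I f = (α.pullback I f).wedge (β.pullback I f) :=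
  funext fun x ↦
    ContinuousAlternatingMap.wedge_compContinuousLinearMap (V := E') (W := E) (α (f x)) (β (f x))
      (mfderiv I I' f x)

end MForm

/-! ### Smoothness, closedness and the Leibniz rule -/

variable (I M A) in
/-- The wedge of smooth forms is smooth (Warner (1983), 2.17), for all degrees.
Named fact (D-0014), the field `isSmoothForm_wedge` of `Literature.NumberTheory.Transcendental.WedgeFacts`. [cite: Warner1983, 2.17] -/
def IsSmoothFormWedge : Prop :=
  ∀ {k l : ℕ} {α : Literature.Geometry.Kaehler.MForm I M A k} {β : Literature.Geometry.Kaehler.MForm I M A l},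
    Literature.Geometry.Kaehler.IsSmoothForm α → Literature.Geometry.Kaehler.IsSmoothForm β → Literature.Geometry.Kaehler.IsSmoothForm (α.wedge β)

/-- Degree casts preserve smoothness (API for `castDeg`; no literature counterpart). [folklore] -/
theorem isSmoothForm_castDeg (h : k = k') {α : Literature.Geometry.Kaehler.MForm I M F k} (hα : Literature.Geometry.Kaehler.IsSmoothForm α) :
    Literature.Geometry.Kaehler.IsSmoothForm (α.castDeg h) := by
  subst h
  exact hα

/-- The exterior derivative commutes with degree casts (API for `castDeg`). [folklore] -/
theorem mextDeriv_castDeg (h : k = k') (α : Literature.Geometry.Kaehler.MForm I M F k) :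
    Literature.Geometry.Kaehler.mextDeriv (α.castDeg h) = (Literature.Geometry.Kaehler.mextDeriv α).castDeg (congrArg (· + 1) h) := by
  subst h
  rfl

/-- Degree casts preserve membership in the closed smooth forms (API for `castDeg`). [folklore] -/
theorem castDeg_mem_closedSmoothForms (h : k = k') {α : Literature.Geometry.Kaehler.MForm I M F k}
    (hα : α ∈ Literature.Geometry.Kaehler.closedSmoothForms I M F k) : α.castDeg h ∈ Literature.Geometry.Kaehler.closedSmoothForms I M F k' := by
  subst h
  exact hα

/-- Degree casts preserve membership in the exact smooth forms (API for `castDeg`). [folklore] -/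
theorem castDeg_mem_exactSmoothForms (h : k = k') {α : Literature.Geometry.Kaehler.MForm I M F k}
    (hα : α ∈ Literature.Geometry.Kaehler.exactSmoothForms I M F k) : α.castDeg h ∈ Literature.Geometry.Kaehler.exactSmoothForms I M F k' := by
  subst h
  exact hα

section Leibniz

/-! No `[IsManifold I ∞ M]` is needed in this section: both sides of the Leibniz rule are
computed by G21's chart-wise `mextDeriv` in the same chart at each point. -/

variable (I M A) in
/-- **Leibniz rule** for the exterior derivative of a wedge product of smooth forms:
`d(α ∧ β) = dα ∧ β + (-1)^k α ∧ dβ` (the first summand cast from degree `(k + 1) + l` to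
`(k + l) + 1`), for all degrees. Stated once for a general normed commutative `ℝ`-algebra `A`
of coefficients (covers `A = ℝ` and `A = ℂ`). Warner (1983), Thm. 2.20(2); Bott–Tu (1982), §I.1.
Named fact (D-0014), the field `mextDeriv_wedge` of `Literature.NumberTheory.Transcendental.WedgeFacts`. [cite: Warner1983, Thm. 2.20(2)] -/
def MextDerivWedge : Prop :=
  ∀ {k l : ℕ} {α : Literature.Geometry.Kaehler.MForm I M A k} {β : Literature.Geometry.Kaehler.MForm I M A l}, Literature.Geometry.Kaehler.IsSmoothForm α → Literature.Geometry.Kaehler.IsSmoothForm β →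
    Literature.Geometry.Kaehler.mextDeriv (α.wedge β) =
      ((Literature.Geometry.Kaehler.mextDeriv α).wedge β).castDeg (Nat.add_right_comm k 1 l) +
        ((-1 : ℝ) ^ k) • α.wedge (Literature.Geometry.Kaehler.mextDeriv β)

variable (I M A) in
/-- **Standing hypotheses of the wedge calculus on `M` with coefficients in `A`.** The named
facts (D-0014) of this file about the wedge product on one manifold whose proofs are deferred —
smoothness of `α ∧ β` (`IsSmoothFormWedge`, Warner (1983), 2.17), the Leibniz rule
(`MextDerivWedge`, Warner (1983), Thm. 2.20(2)), and associativity / graded commutativity of the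
pointwise wedge on the model space (`ContinuousAlternatingMap.WedgeAssoc`, `.WedgeComm`,
Warner (1983), 2.6 / 2.10) — bundled as a `Prop`-valued class (house pattern
`SphereEmbedding.SmoothnessFacts` / `HodgeTensorFacts` / `Kerr.Facts`), so that
`IsClosedForm.wedge`, `wedge_mem_closedSmoothForms`, `wedge_mem_exactSmoothForms_of_left/right`,
`MForm.wedge_assoc/comm`, `deRhamCohomology.closedWedge` and `deRhamCohomology.cup` take them as
the single instance hypothesis `[WedgeFacts I M A]`. [cite: Warner1983, 2.6–2.20] -/
class WedgeFacts : Prop where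
  /-- The wedge of smooth forms is smooth (`IsSmoothFormWedge`). -/
  isSmoothForm_wedge : IsSmoothFormWedge I M A
  /-- The Leibniz rule (`MextDerivWedge`). -/
  mextDeriv_wedge : MextDerivWedge I M A
  /-- Associativity of the pointwise wedge (`ContinuousAlternatingMap.WedgeAssoc`). -/
  wedge_assoc : ContinuousAlternatingMap.WedgeAssoc ℝ E A
  /-- Graded commutativity of the pointwise wedge (`ContinuousAlternatingMap.WedgeComm`). -/
  wedge_comm : ContinuousAlternatingMap.WedgeComm ℝ E A

/-- The wedge of smooth forms is smooth (Warner (1983), 2.17; the named fact `IsSmoothFormWedge`,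
via `[WedgeFacts I M A]`). [cite: Warner1983, 2.17] -/
theorem isSmoothForm_wedge [WedgeFacts I M A] {α : Literature.Geometry.Kaehler.MForm I M A k} {β : Literature.Geometry.Kaehler.MForm I M A l}
    (hα : Literature.Geometry.Kaehler.IsSmoothForm α) (hβ : Literature.Geometry.Kaehler.IsSmoothForm β) : Literature.Geometry.Kaehler.IsSmoothForm (α.wedge β) :=
  WedgeFacts.isSmoothForm_wedge hα hβ

/-- **Leibniz rule** `d(α ∧ β) = dα ∧ β + (-1)^k α ∧ dβ` for smooth forms (Warner (1983),
Thm. 2.20(2); Bott–Tu (1982), §I.1; the named fact `MextDerivWedge`, via `[WedgeFacts I M A]`). [cite: Warner1983, Thm. 2.20(2)] -/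
theorem mextDeriv_wedge [WedgeFacts I M A] {α : Literature.Geometry.Kaehler.MForm I M A k} {β : Literature.Geometry.Kaehler.MForm I M A l}
    (hα : Literature.Geometry.Kaehler.IsSmoothForm α) (hβ : Literature.Geometry.Kaehler.IsSmoothForm β) :
    Literature.Geometry.Kaehler.mextDeriv (α.wedge β) =
      ((Literature.Geometry.Kaehler.mextDeriv α).wedge β).castDeg (Nat.add_right_comm k 1 l) +
        ((-1 : ℝ) ^ k) • α.wedge (Literature.Geometry.Kaehler.mextDeriv β) :=
  WedgeFacts.mextDeriv_wedge hα hβ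

/-- **Associativity** of the wedge of forms, with the degree cast along
`k + (l + m) = (k + l) + m` (pointwise from the named fact `ContinuousAlternatingMap.WedgeAssoc`,
via `[WedgeFacts I M A]`; Warner (1983), 2.6). [cite: Warner1983, 2.6] -/
theorem _root_.Literature.Geometry.Kaehler.MForm.wedge_assoc [WedgeFacts I M A] (α : Literature.Geometry.Kaehler.MForm I M A k) (β : Literature.Geometry.Kaehler.MForm I M A l)
    (γ : Literature.Geometry.Kaehler.MForm I M A m) :
    (α.wedge β).wedge γ = (α.wedge (β.wedge γ)).castDeg (Nat.add_assoc k l m).symm :=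
  funext fun x ↦ WedgeFacts.wedge_assoc (I := I) (M := M) (α x) (β x) (γ x)

/-- **Graded commutativity** of the wedge of forms: `β ∧ α = (-1)^{kl} α ∧ β`, with the degree
cast along `k + l = l + k` (pointwise from the named fact `ContinuousAlternatingMap.WedgeComm`,
via `[WedgeFacts I M A]`; Warner (1983), 2.6). [cite: Warner1983, 2.6] -/
theorem _root_.Literature.Geometry.Kaehler.MForm.wedge_comm [WedgeFacts I M A] (α : Literature.Geometry.Kaehler.MForm I M A k) (β : Literature.Geometry.Kaehler.MForm I M A l) :
    β.wedge α = ((-1 : ℝ) ^ (k * l)) • (α.wedge β).castDeg (Nat.add_comm k l) :=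
  funext fun x ↦ WedgeFacts.wedge_comm (I := I) (M := M) (α x) (β x)

/-- The wedge of closed smooth forms is closed (from the Leibniz rule; Warner (1983), 2.20;
Bott–Tu (1982), §I.1). [cite: Warner1983, 2.20] -/
theorem _root_.Literature.Geometry.Kaehler.IsClosedForm.wedge [WedgeFacts I M A] {α : Literature.Geometry.Kaehler.MForm I M A k} {β : Literature.Geometry.Kaehler.MForm I M A l}
    (hα : Literature.Geometry.Kaehler.IsClosedForm α) (hβ : Literature.Geometry.Kaehler.IsClosedForm β) (hαs : Literature.Geometry.Kaehler.IsSmoothForm α) (hβs : Literature.Geometry.Kaehler.IsSmoothForm β) :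
    Literature.Geometry.Kaehler.IsClosedForm (α.wedge β) := by
  rw [Literature.Geometry.Kaehler.IsClosedForm] at hα hβ ⊢
  rw [mextDeriv_wedge hαs hβs, hα, hβ, Literature.Geometry.Kaehler.MForm.zero_wedge, Literature.Geometry.Kaehler.MForm.wedge_zero, Literature.Geometry.Kaehler.MForm.castDeg_zero,
    smul_zero, add_zero]

/-- The wedge of closed smooth forms is a closed smooth form (Warner (1983), 2.20; Bott–Tu
(1982), §I.1). [cite: Warner1983, 2.20] -/
theorem wedge_mem_closedSmoothForms [WedgeFacts I M A] {α : Literature.Geometry.Kaehler.MForm I M A k} {β : Literature.Geometry.Kaehler.MForm I M A l}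
    (hα : α ∈ Literature.Geometry.Kaehler.closedSmoothForms I M A k) (hβ : β ∈ Literature.Geometry.Kaehler.closedSmoothForms I M A l) :
    α.wedge β ∈ Literature.Geometry.Kaehler.closedSmoothForms I M A (k + l) :=
  ⟨isSmoothForm_wedge hα.1 hβ.1, hα.2.wedge hβ.2 hα.1 hβ.1⟩

/-- Exact ∧ closed is exact: `dγ ∧ β = d(γ ∧ β)` for closed `β` (Warner (1983), 2.20;
Bott–Tu (1982), §I.1: the wedge descends to cohomology). Proof: by `span_induction` on the
exact factor, using the Leibniz rule with `dβ = 0`. [cite: Warner1983, 2.20] -/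
theorem wedge_mem_exactSmoothForms_of_left [WedgeFacts I M A] {α : Literature.Geometry.Kaehler.MForm I M A k}
    {β : Literature.Geometry.Kaehler.MForm I M A l} (hα : α ∈ Literature.Geometry.Kaehler.exactSmoothForms I M A k)
    (hβ : β ∈ Literature.Geometry.Kaehler.closedSmoothForms I M A l) : α.wedge β ∈ Literature.Geometry.Kaehler.exactSmoothForms I M A (k + l) := by
  cases k with
  | zero =>
    simp only [Literature.Geometry.Kaehler.exactSmoothForms, Submodule.mem_bot] at hα
    rw [hα, Literature.Geometry.Kaehler.MForm.zero_wedge]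
    exact zero_mem _
  | succ k =>
    have hkl : k + l + 1 = k + 1 + l := Nat.add_right_comm k l 1
    suffices h : (α.wedge β).castDeg hkl.symm ∈ Literature.Geometry.Kaehler.exactSmoothForms I M A (k + l + 1) from
      castDeg_mem_exactSmoothForms hkl h
    simp only [Literature.Geometry.Kaehler.exactSmoothForms] at hα ⊢
    refine Submodule.span_induction ?_ ?_ ?_ ?_ hα
    · rintro _ ⟨γ, hγ, rfl⟩
      have hγ : Literature.Geometry.Kaehler.IsSmoothForm γ := hγ
      have hL := mextDeriv_wedge hγ hβ.1
      rw [show Literature.Geometry.Kaehler.mextDeriv β = 0 from hβ.2, Literature.Geometry.Kaehler.MForm.wedge_zero, smul_zero, add_zero] at hL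
      rw [← hL]
      exact Submodule.subset_span ⟨γ.wedge β, isSmoothForm_wedge hγ hβ.1, rfl⟩
    · rw [Literature.Geometry.Kaehler.MForm.zero_wedge, Literature.Geometry.Kaehler.MForm.castDeg_zero]
      exact zero_mem _
    · intro a b _ _ ha hb
      rw [Literature.Geometry.Kaehler.MForm.wedge_add_left, Literature.Geometry.Kaehler.MForm.castDeg_add]
      exact add_mem ha hb
    · intro c a _ ha
      rw [Literature.Geometry.Kaehler.MForm.wedge_smul_left, Literature.Geometry.Kaehler.MForm.castDeg_smul]
      exact Submodule.smul_mem _ c ha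

/-- Closed ∧ exact is exact: `α ∧ dγ = (-1)^k d(α ∧ γ)` for closed `α` (Warner (1983), 2.20;
Bott–Tu (1982), §I.1). Proof: by `span_induction` on the exact factor, using the Leibniz rule
with `dα = 0`. [cite: Warner1983, 2.20] -/
theorem wedge_mem_exactSmoothForms_of_right [WedgeFacts I M A] {α : Literature.Geometry.Kaehler.MForm I M A k}
    {β : Literature.Geometry.Kaehler.MForm I M A l} (hα : α ∈ Literature.Geometry.Kaehler.closedSmoothForms I M A k)
    (hβ : β ∈ Literature.Geometry.Kaehler.exactSmoothForms I M A l) : α.wedge β ∈ Literature.Geometry.Kaehler.exactSmoothForms I M A (k + l) := by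
  cases l with
  | zero =>
    simp only [Literature.Geometry.Kaehler.exactSmoothForms, Submodule.mem_bot] at hβ
    rw [hβ, Literature.Geometry.Kaehler.MForm.wedge_zero]
    exact zero_mem _
  | succ l =>
    show α.wedge β ∈ Literature.Geometry.Kaehler.exactSmoothForms I M A (k + l + 1)
    simp only [Literature.Geometry.Kaehler.exactSmoothForms] at hβ ⊢
    refine Submodule.span_induction ?_ ?_ ?_ ?_ hβ
    · rintro _ ⟨γ, hγ, rfl⟩
      have hγ : Literature.Geometry.Kaehler.IsSmoothForm γ := hγ
      have hL := mextDeriv_wedge hα.1 hγ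
      rw [show Literature.Geometry.Kaehler.mextDeriv α = 0 from hα.2, Literature.Geometry.Kaehler.MForm.zero_wedge, Literature.Geometry.Kaehler.MForm.castDeg_zero, zero_add] at hL
      have h2 : α.wedge (Literature.Geometry.Kaehler.mextDeriv γ) = ((-1 : ℝ) ^ k) • Literature.Geometry.Kaehler.mextDeriv (α.wedge γ) := by
        rw [hL, smul_smul, ← pow_add, ← two_mul, pow_mul, neg_one_sq, one_pow, one_smul]
      rw [h2]
      exact Submodule.smul_mem _ _
        (Submodule.subset_span ⟨α.wedge γ, isSmoothForm_wedge hα.1 hγ, rfl⟩)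
    · rw [Literature.Geometry.Kaehler.MForm.wedge_zero]
      exact zero_mem _
    · intro a b _ _ ha hb
      rw [Literature.Geometry.Kaehler.MForm.wedge_add_right]
      exact add_mem ha hb
    · intro c a _ ha
      rw [Literature.Geometry.Kaehler.MForm.wedge_smul_right]
      exact Submodule.smul_mem _ c ha

end Leibniz

/-! ### Calculus of the pull-back -/

section Pullback

variable (I M I' N F) in
/-- The pull-back of a smooth form along a `C^∞` map is smooth (Warner (1983), 2.22–2.23), for
all degrees and all `C^∞` maps `f : M → N` (between `C^∞` manifolds: both
`IsManifold` instances are bound). Named fact (D-0014), the field `isSmoothForm_pullback` of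
`Literature.NumberTheory.Transcendental.PullbackFacts`. [cite: Warner1983, 2.22–2.23] -/
def IsSmoothFormPullback [IsManifold I ∞ M] [IsManifold I' ∞ N] : Prop :=
  ∀ {k : ℕ} {f : M → N}, ContMDiff I I' ∞ f → ∀ {β : Literature.Geometry.Kaehler.MForm I' N F k},
    Literature.Geometry.Kaehler.IsSmoothForm β → Literature.Geometry.Kaehler.IsSmoothForm (β.pullback I f)

variable (I M I' N F) in
/-- **Naturality of `d`**: `d(f^* β) = f^*(dβ)` for a `C^∞` map `f` and a smooth form `β`
(Warner (1983), Prop. 2.23; the manifold form of Mathlib's `extDeriv_pullback`), for all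
degrees (both `IsManifold` instances are bound). Named fact (D-0014), the field
`mextDeriv_pullback` of `Literature.NumberTheory.Transcendental.PullbackFacts`. [cite: Warner1983, Prop. 2.23] -/
def MextDerivPullback [IsManifold I ∞ M] [IsManifold I' ∞ N] : Prop :=
  ∀ {k : ℕ} {f : M → N}, ContMDiff I I' ∞ f → ∀ {β : Literature.Geometry.Kaehler.MForm I' N F k},
    Literature.Geometry.Kaehler.IsSmoothForm β → Literature.Geometry.Kaehler.mextDeriv (β.pullback I f) = (Literature.Geometry.Kaehler.mextDeriv β).pullback I f

variable (I M I' N F) in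
/-- **Standing hypotheses of the pull-back calculus along maps `M → N` with coefficients in
`F`.** The named facts (D-0014) of this file about pull-backs whose proofs are deferred —
smoothness of `f^* β` (`IsSmoothFormPullback`, Warner (1983), 2.22–2.23) and naturality of `d`
(`MextDerivPullback`, Warner (1983), Prop. 2.23) — bundled as a `Prop`-valued class (house
pattern `SphereEmbedding.SmoothnessFacts` / `HodgeTensorFacts` / `Kerr.Facts`), so that
`pullback_mem_closedSmoothForms`, `pullback_mem_exactSmoothForms` and `deRhamCohomology.map`
take them as the single instance hypothesis `[PullbackFacts I M I' N F]`. [cite: Warner1983, 2.22–2.23] -/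
class PullbackFacts [IsManifold I ∞ M] [IsManifold I' ∞ N] : Prop where
  /-- The pull-back of a smooth form along a `C^∞` map is smooth (`IsSmoothFormPullback`). -/
  isSmoothForm_pullback : IsSmoothFormPullback I M I' N F
  /-- Naturality of `d` (`MextDerivPullback`). -/
  mextDeriv_pullback : MextDerivPullback I M I' N F

variable [IsManifold I ∞ M] [IsManifold I' ∞ N]

/-- The pull-back of a smooth form along a `C^∞` map is smooth (Warner (1983), 2.22–2.23; the
named fact `IsSmoothFormPullback`, via `[PullbackFacts I M I' N F]`). [cite: Warner1983, 2.22–2.23] -/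
theorem isSmoothForm_pullback [PullbackFacts I M I' N F] {f : M → N} (hf : ContMDiff I I' ∞ f)
    {β : Literature.Geometry.Kaehler.MForm I' N F k} (hβ : Literature.Geometry.Kaehler.IsSmoothForm β) : Literature.Geometry.Kaehler.IsSmoothForm (β.pullback I f) :=
  PullbackFacts.isSmoothForm_pullback hf hβ

/-- **Naturality of `d`**: `d(f^* β) = f^*(dβ)` for a `C^∞` map `f` and a smooth form `β`
(Warner (1983), Prop. 2.23; the named fact `MextDerivPullback`, via
`[PullbackFacts I M I' N F]`). [cite: Warner1983, Prop. 2.23] -/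
theorem mextDeriv_pullback [PullbackFacts I M I' N F] {f : M → N} (hf : ContMDiff I I' ∞ f)
    {β : Literature.Geometry.Kaehler.MForm I' N F k} (hβ : Literature.Geometry.Kaehler.IsSmoothForm β) :
    Literature.Geometry.Kaehler.mextDeriv (β.pullback I f) = (Literature.Geometry.Kaehler.mextDeriv β).pullback I f :=
  PullbackFacts.mextDeriv_pullback hf hβ

/-- Pull-back along a `C^∞` map preserves closed smooth forms (Warner (1983), 2.23;
Bott–Tu (1982), §I.2). [cite: Warner1983, 2.23] -/
theorem pullback_mem_closedSmoothForms [PullbackFacts I M I' N F] {f : M → N}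
    (hf : ContMDiff I I' ∞ f) {β : Literature.Geometry.Kaehler.MForm I' N F k} (hβ : β ∈ Literature.Geometry.Kaehler.closedSmoothForms I' N F k) :
    β.pullback I f ∈ Literature.Geometry.Kaehler.closedSmoothForms I M F k := by
  refine ⟨isSmoothForm_pullback hf hβ.1, ?_⟩
  have h : Literature.Geometry.Kaehler.mextDeriv β = 0 := hβ.2
  rw [Literature.Geometry.Kaehler.IsClosedForm, mextDeriv_pullback hf hβ.1, h, Literature.Geometry.Kaehler.MForm.pullback_zero]

/-- Pull-back along a `C^∞` map preserves exact smooth forms: `f^*(dγ) = d(f^*γ)`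
(Warner (1983), 2.23; Bott–Tu (1982), §I.2). Proof: by `span_induction`, using naturality
of `d`. [cite: Warner1983, 2.23] -/
theorem pullback_mem_exactSmoothForms [PullbackFacts I M I' N F] {f : M → N}
    (hf : ContMDiff I I' ∞ f) {β : Literature.Geometry.Kaehler.MForm I' N F k} (hβ : β ∈ Literature.Geometry.Kaehler.exactSmoothForms I' N F k) :
    β.pullback I f ∈ Literature.Geometry.Kaehler.exactSmoothForms I M F k := by
  cases k with
  | zero =>
    simp only [Literature.Geometry.Kaehler.exactSmoothForms, Submodule.mem_bot] at hβ ⊢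
    rw [hβ, Literature.Geometry.Kaehler.MForm.pullback_zero]
  | succ k =>
    simp only [Literature.Geometry.Kaehler.exactSmoothForms] at hβ ⊢
    refine Submodule.span_induction ?_ ?_ ?_ ?_ hβ
    · rintro _ ⟨γ, hγ, rfl⟩
      have hγ : Literature.Geometry.Kaehler.IsSmoothForm γ := hγ
      rw [← mextDeriv_pullback hf hγ]
      exact Submodule.subset_span ⟨γ.pullback I f, isSmoothForm_pullback hf hγ, rfl⟩
    · rw [Literature.Geometry.Kaehler.MForm.pullback_zero]
      exact zero_mem _
    · intro a b _ _ ha hb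
      rw [Literature.Geometry.Kaehler.MForm.pullback_add]
      exact add_mem ha hb
    · intro c a _ ha
      rw [Literature.Geometry.Kaehler.MForm.pullback_smul]
      exact Submodule.smul_mem _ c ha

end Pullback

/-- G21's chart representative `α.inChart x₀` *is* the pull-back of `α` along the inverse
extended chart `(extChartAt I x₀).symm : E → M`, for boundaryless models (where
`mfderivWithin (range I) = mfderiv`). Warner (1983), §2.18. [cite: Warner1983] -/
theorem inChart_eq_pullback [I.Boundaryless] (α : Literature.Geometry.Kaehler.MForm I M F k) (x₀ : M) :
    α.inChart x₀ = α.pullback 𝓘(ℝ, E) (extChartAt I x₀).symm := by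
  funext y
  simp only [Literature.Geometry.Kaehler.MForm.inChart, Literature.Geometry.Kaehler.MForm.pullback, ← mfderivWithin_univ, ModelWithCorners.range_eq_univ]
  rfl

variable (E F) in
/-- **Poincaré lemma.** On a convex open subset `U` of a complete normed space `E` (a manifold
via `𝓘(ℝ, E)`), every closed smooth form of positive degree with values in a *complete* space
`F` is exact: `B^{k+1}(U) = Z^{k+1}(U)`. Completeness of `F` is needed (the homotopy operator
integrates along rays; for `F = c₀₀` there are closed non-exact smooth `1`-forms on `ℝ`);
completeness of `E` is assumed to match the printed sources (Warner / Bott–Tu: `E = ℝⁿ`; Lang: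
`E` Banach). (In degree `0` the closed forms are the locally constant functions and `B⁰ = 0`.)
Warner (1983), 4.18; Bott–Tu (1982), Cor. 4.1.1; Lang, *Differential and Riemannian
Manifolds*, V §4. Named fact (D-0014). [cite: Warner1983, 4.18] -/
def ExactSmoothFormsEqClosedSmoothFormsOfConvex [CompleteSpace E] [CompleteSpace F] : Prop :=
  ∀ (U : TopologicalSpace.Opens E), Convex ℝ (U : Set E) → ∀ k : ℕ,
    Literature.Geometry.Kaehler.exactSmoothForms 𝓘(ℝ, E) U F (k + 1) = Literature.Geometry.Kaehler.closedSmoothForms 𝓘(ℝ, E) U F (k + 1)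

/-! ### Induced maps on de Rham cohomology and the cup product -/

section deRhamCohomology
open Literature.Geometry.Kaehler (deRhamCohomology)
open Literature.Geometry.Kaehler.deRhamCohomology

section Map

variable [IsManifold I ∞ M] [IsManifold I' ∞ N] [IsManifold I'' ∞ P]

/-- The map `f^* : H^k_{dR}(N; F) → H^k_{dR}(M; F)` induced on de Rham cohomology by a `C^∞` map
`f : M → N` (pull-back of representatives, via `Submodule.mapQ`). Warner (1983), 4.6 / 5.28;
Bott–Tu (1982), §I.2. Relies on: the named facts `IsSmoothFormPullback`, `MextDerivPullback`
(via `[PullbackFacts I M I' N F]`, through `pullback_mem_closedSmoothForms`,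
`pullback_mem_exactSmoothForms`). [cite: Warner1983, 4.6] -/
def _root_.Literature.Geometry.Kaehler.deRhamCohomology.map [PullbackFacts I M I' N F] {f : M → N} (hf : ContMDiff I I' ∞ f) (k : ℕ) :
    deRhamCohomology I' N F k →ₗ[ℝ] deRhamCohomology I M F k :=
  Submodule.mapQ _ _
    ((Literature.Geometry.Kaehler.MForm.pullbackₗ I f k).restrict fun _ hβ ↦ pullback_mem_closedSmoothForms hf hβ)
    fun _ hβ ↦ pullback_mem_exactSmoothForms hf hβ

/-- `f^*` on the class of a closed form is the class of the pulled-back form (definitional;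
Warner (1983), 4.6). [cite: Warner1983, 4.6] -/
theorem _root_.Literature.Geometry.Kaehler.deRhamCohomology.map_mk [PullbackFacts I M I' N F] {f : M → N} (hf : ContMDiff I I' ∞ f)
    (β : Literature.Geometry.Kaehler.closedSmoothForms I' N F k) :
    map hf k (mk β) =
      mk ⟨(β : Literature.Geometry.Kaehler.MForm I' N F k).pullback I f, pullback_mem_closedSmoothForms hf β.2⟩ :=
  rfl

/-- Functoriality: the identity induces the identity on de Rham cohomology
(Warner (1983), 4.6). [cite: Warner1983, 4.6] -/
theorem _root_.Literature.Geometry.Kaehler.deRhamCohomology.map_id [PullbackFacts I M I M F] (k : ℕ) :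
    map (contMDiff_id : ContMDiff I I ∞ (id : M → M)) k =
      LinearMap.id (M := deRhamCohomology I M F k) := by
  refine Submodule.linearMap_qext _ (LinearMap.ext fun β ↦ ?_)
  change map contMDiff_id k (mk β) = mk β
  rw [map_mk]
  congr 1
  exact Subtype.ext (Literature.Geometry.Kaehler.MForm.pullback_id _)

/-- Functoriality: `(g ∘ f)^* = f^* ∘ g^*` on de Rham cohomology (Warner (1983), 4.6). [cite: Warner1983, 4.6] -/
theorem _root_.Literature.Geometry.Kaehler.deRhamCohomology.map_comp [PullbackFacts I M I' N F] [PullbackFacts I' N I'' P F] [PullbackFacts I M I'' P F]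
    {g : N → P} {f : M → N} (hg : ContMDiff I' I'' ∞ g) (hf : ContMDiff I I' ∞ f) (k : ℕ) :
    (map (hg.comp hf) k : deRhamCohomology I'' P F k →ₗ[ℝ] deRhamCohomology I M F k) =
      map hf k ∘ₗ map hg k := by
  refine Submodule.linearMap_qext _ (LinearMap.ext fun γ ↦ ?_)
  change map (hg.comp hf) k (mk γ) = map hf k (map hg k (mk γ))
  rw [map_mk, map_mk, map_mk]
  congr 1
  exact Subtype.ext (Literature.Geometry.Kaehler.MForm.pullback_comp (hg.mdifferentiable (by simp))
    (hf.mdifferentiable (by simp)) _)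

end Map

section Cup

variable [WedgeFacts I M A]

/-- The wedge product on closed smooth forms, as an `ℝ`-bilinear map
`Z^k × Z^l → Z^m` (`k + l = m`). Warner (1983), 2.6 / 2.20.
Relies on: the named facts `IsSmoothFormWedge`, `MextDerivWedge` (via `[WedgeFacts I M A]`,
through `wedge_mem_closedSmoothForms`). [cite: Warner1983, 2.20] -/
def _root_.Literature.Geometry.Kaehler.deRhamCohomology.closedWedge (h : k + l = m) :
    Literature.Geometry.Kaehler.closedSmoothForms I M A k →ₗ[ℝ] Literature.Geometry.Kaehler.closedSmoothForms I M A l →ₗ[ℝ] Literature.Geometry.Kaehler.closedSmoothForms I M A m :=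
  LinearMap.mk₂ ℝ
    (fun α β ↦ ⟨((α : Literature.Geometry.Kaehler.MForm I M A k).wedge (β : Literature.Geometry.Kaehler.MForm I M A l)).castDeg h,
      castDeg_mem_closedSmoothForms h (wedge_mem_closedSmoothForms α.2 β.2)⟩)
    (fun _ _ _ ↦ Subtype.ext <| by simp [Literature.Geometry.Kaehler.MForm.wedge_add_left])
    (fun _ _ _ ↦ Subtype.ext <| by simp [Literature.Geometry.Kaehler.MForm.wedge_smul_left])
    (fun _ _ _ ↦ Subtype.ext <| by simp [Literature.Geometry.Kaehler.MForm.wedge_add_right])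
    (fun _ _ _ ↦ Subtype.ext <| by simp [Literature.Geometry.Kaehler.MForm.wedge_smul_right])

/-- The form underlying `closedWedge h α β` is `(α ∧ β).castDeg h` (definitional;
Warner (1983), 2.6). [cite: Warner1983, 2.6] -/
@[simp]
theorem _root_.Literature.Geometry.Kaehler.deRhamCohomology.coe_closedWedge (h : k + l = m) (α : Literature.Geometry.Kaehler.closedSmoothForms I M A k)
    (β : Literature.Geometry.Kaehler.closedSmoothForms I M A l) :
    (closedWedge h α β : Literature.Geometry.Kaehler.MForm I M A m) =
      ((α : Literature.Geometry.Kaehler.MForm I M A k).wedge (β : Literature.Geometry.Kaehler.MForm I M A l)).castDeg h :=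
  rfl

/-- The **cup product** `⌣ : H^k_{dR}(M; A) × H^l_{dR}(M; A) → H^m_{dR}(M; A)` (`k + l = m`)
induced by the wedge product of representatives, `[α] ⌣ [β] = [α ∧ β]`; well defined because
exact ∧ closed and closed ∧ exact are exact. Bott–Tu (1982), §I.1 (p. 14); Warner (1983),
4.6 / 5.28. Relies on: the named facts `IsSmoothFormWedge`, `MextDerivWedge` (via
`[WedgeFacts I M A]`, through `wedge_mem_exactSmoothForms_of_left`,
`wedge_mem_exactSmoothForms_of_right`). [cite: BottTu1982, §I.1] -/
def _root_.Literature.Geometry.Kaehler.deRhamCohomology.cup (h : k + l = m) :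
    deRhamCohomology I M A k →ₗ[ℝ] deRhamCohomology I M A l →ₗ[ℝ] deRhamCohomology I M A m :=
  letI B : Literature.Geometry.Kaehler.closedSmoothForms I M A k →ₗ[ℝ] Literature.Geometry.Kaehler.closedSmoothForms I M A l →ₗ[ℝ]
      deRhamCohomology I M A m :=
    (closedWedge h).compr₂ mk
  letI B₁ : deRhamCohomology I M A l →ₗ[ℝ] Literature.Geometry.Kaehler.closedSmoothForms I M A k →ₗ[ℝ]
      deRhamCohomology I M A m :=
    Submodule.liftQ _ B.flip fun β hβ ↦ by
      rw [LinearMap.mem_ker]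
      refine LinearMap.ext fun α ↦ ?_
      exact (Submodule.Quotient.mk_eq_zero _).2
        (castDeg_mem_exactSmoothForms h (wedge_mem_exactSmoothForms_of_right α.2 hβ))
  Submodule.liftQ _ B₁.flip fun α hα ↦ by
    rw [LinearMap.mem_ker]
    refine Submodule.linearMap_qext _ (LinearMap.ext fun β ↦ ?_)
    exact (Submodule.Quotient.mk_eq_zero _).2
      (castDeg_mem_exactSmoothForms h (wedge_mem_exactSmoothForms_of_left hα β.2))

/-- The cup product of classes is the class of the wedge: `[α] ⌣ [β] = [α ∧ β]`
(definitional; Bott–Tu (1982), §I.1). [cite: BottTu1982, §I.1] -/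
theorem _root_.Literature.Geometry.Kaehler.deRhamCohomology.cup_mk_mk (h : k + l = m) (α : Literature.Geometry.Kaehler.closedSmoothForms I M A k) (β : Literature.Geometry.Kaehler.closedSmoothForms I M A l) :
    cup h (mk α) (mk β) = mk (closedWedge h α β) :=
  rfl

/-- **Graded commutativity** of the cup product: `b ⌣ a = (-1)^{kl} a ⌣ b`
(Bott–Tu (1982), §I.1; Warner (1983), 2.6). Proof: on representatives, from
`MForm.wedge_comm`. [cite: BottTu1982, §I.1] -/
theorem _root_.Literature.Geometry.Kaehler.deRhamCohomology.cup_gradedComm (h : k + l = m) (h' : l + k = m) (a : deRhamCohomology I M A k)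
    (b : deRhamCohomology I M A l) : cup h' b a = ((-1 : ℝ) ^ (k * l)) • cup h a b := by
  obtain ⟨α, rfl⟩ := mk_surjective a
  obtain ⟨β, rfl⟩ := mk_surjective b
  rw [cup_mk_mk, cup_mk_mk, ← map_smul]
  congr 1
  refine Subtype.ext ?_
  simp only [coe_closedWedge, Submodule.coe_smul]
  rw [Literature.Geometry.Kaehler.MForm.wedge_comm (α : Literature.Geometry.Kaehler.MForm I M A k) (β : Literature.Geometry.Kaehler.MForm I M A l), Literature.Geometry.Kaehler.MForm.castDeg_smul,
    Literature.Geometry.Kaehler.MForm.castDeg_castDeg]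

/-- **Associativity** of the cup product: `(a ⌣ b) ⌣ c = a ⌣ (b ⌣ c)`
(Bott–Tu (1982), §I.1; Warner (1983), 2.6). Proof: on representatives, from
`MForm.wedge_assoc`. [cite: BottTu1982, §I.1] -/
theorem _root_.Literature.Geometry.Kaehler.deRhamCohomology.cup_assoc {kl lm n : ℕ} (hkl : k + l = kl) (hklm : kl + m = n) (hlm : l + m = lm)
    (hklm' : k + lm = n) (a : deRhamCohomology I M A k) (b : deRhamCohomology I M A l)
    (c : deRhamCohomology I M A m) :
    cup hklm (cup hkl a b) c = cup hklm' a (cup hlm b c) := by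
  obtain ⟨α, rfl⟩ := mk_surjective a
  obtain ⟨β, rfl⟩ := mk_surjective b
  obtain ⟨γ, rfl⟩ := mk_surjective c
  simp only [cup_mk_mk]
  congr 1
  refine Subtype.ext ?_
  subst hkl hlm hklm
  simp only [coe_closedWedge, Literature.Geometry.Kaehler.MForm.castDeg_rfl]
  rw [Literature.Geometry.Kaehler.MForm.wedge_assoc]

variable [IsManifold I ∞ M] [IsManifold I' ∞ N]

/-- **Naturality** of the cup product: `f^*(a ⌣ b) = f^* a ⌣ f^* b`
(Bott–Tu (1982), §I.2). Proof: on representatives, from `MForm.pullback_wedge` and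
`MForm.pullback_castDeg`. [cite: BottTu1982, §I.2] -/
theorem _root_.Literature.Geometry.Kaehler.deRhamCohomology.cup_map [WedgeFacts I' N A] [PullbackFacts I M I' N A] (h : k + l = m) {f : M → N}
    (hf : ContMDiff I I' ∞ f) (a : deRhamCohomology I' N A k) (b : deRhamCohomology I' N A l) :
    map hf m (cup h a b) = cup h (map hf k a) (map hf l b) := by
  obtain ⟨α, rfl⟩ := mk_surjective a
  obtain ⟨β, rfl⟩ := mk_surjective b
  rw [cup_mk_mk, map_mk, map_mk, map_mk, cup_mk_mk]
  congr 1
  refine Subtype.ext ?_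
  simp only [coe_closedWedge, Literature.Geometry.Kaehler.MForm.pullback_castDeg, Literature.Geometry.Kaehler.MForm.pullback_wedge]

end Cup

end deRhamCohomology

end Literature.NumberTheory.Transcendental
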